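import Literature.AnabelianGeometry.EtaleTheta.KummerMapExactness
import Literature.AnabelianGeometry.AbsoluteAnabelian.AbsTopIII.KummerFaithfulToral
import Literature.AnabelianGeometry.AbsoluteAnabelian.AbsTopIII.KummerFaithfulProofs
import Literature.AnabelianGeometry.AbsoluteAnabelian.AbsTopIII.KummerFaithfulSubpadicProofs
import HarnessLib

/-!
# [AbsTopIII] Cor 5.2 (iii), the `↪`, at the GENUINE global arithmetic data of a number field:
# the Kummer map `F̄^× → lim_{→ J} H¹(J, Λ(F̄^×))` over the open subgroups `J ⊆ G_F` is injective

S. Mochizuki, *Topics in absolute anabelian geometry III* [MochizukiAbsTopIII2015], Cor 5.2 (iii) p. 119 (kurims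
manuscript): "there exists a functorial […] algorithm for constructing the Kummer map
`M⊚_TM ⥲ (M⊚_TM)^gp ⥲ M⊚_TLG ↪ lim_{→J} H¹(J, μ_Ẑ(M⊚_TM)) ⥲ lim_{→J} H¹(J, μ_Ẑ(Π))` — where “`J`” ranges over the open
subgroups of `Π`", the global arithmetic data being `M⊚ ≅ k̄^×_NF(Π) ≅ F̄^×` (Def 5.1 (ii), (v)) with its Galois action.

The cell's typing (`GlobalKummerMaps.lean`, abc-iut-L4-t3) CONSTRUCTS that Kummer map over an abstract carrier and
records the "`↪`" as the named fact `Cor52iiiKummerInjective`; abc-iut-w6-d033's `globalKummerMap_injective_of`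
(`GlobalKummerMapsInjectiveProofs.lean`) reduces it to the level-wise condition

> for every open `J ⊆ Π`: an element of `|M⊚|` fixed by `J` and admitting, for every `n ≥ 1`, an `n`-th root fixed
> by `J` is trivial.

THIS PROOF-ONLY FILE (no definitions, no named facts; abc-iut-L4-d2, row «COR52III-NF-MODEL») proves that
condition, and the injectivity itself, for the GENUINE global data of a number field `F` — `G_F = Gal(F̄/F)`
(`Field.absoluteGaloisGroup F`) acting on `F̄^×` (tree instance `instMulDistribMulActionUnits`) — WITHOUT the
`TPairVocabulary` packaging (whose genuine number-field instance needs a genuine `GlobalAnabelianContext`, the §5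
Def 5.1 (i)–(iv) model, not in the tree):

* `units_eq_one_of_fixed_of_forall_exists_fixed_pow` — **the level-wise condition at the genuine data**: for an open
  subgroup `J ⊆ G_F`, a `J`-fixed unit `a ∈ F̄^×` having, for every `n ≥ 1`, a `J`-fixed `n`-th root is `1` —
  [AbsTopIII] Def 1.5 (b) for tori over the number field `F` (`AbsTopIII.def_1_5_b_toral_of_isTorallyKummerFaithful`
  with Rmk 1.5.3 (i) `AbsTopIII.isTorallyKummerFaithful_of_numberField`, read through the kernel criterion
  `kummerMapFixed_injective_iff_absoluteGaloisGroup` — all IN TREE, BY NAME); this is EXACTLY the hypothesis `h` of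
  `globalKummerMap_injective_of` read at carrier `F̄^×`, action = the Galois action;
* `divisibleElementsTrivial_invariants_of_isOpen` — the same as `AbsTopIII.DivisibleElementsTrivial ↥((F̄^×)^J)`;
* `isExhausted_units_openSubgroups` — hypothesis (c) of the Kummer-map construction, `F̄^× = ⋃_J (F̄^×)^J`
  (stabilisers are open: `Gal(F̄/F(a))`);
* `kummerMapHom_openSubgroups_injective` — **the Kummer map `F̄^× → lim_{→ J open} H¹(J, Λ(F̄^×))`
  (abc-iut-L2-t3's `EtaleTheta.kummerMapHom` over the system of ALL open subgroups of `G_F`) is INJECTIVE** —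
  the printed "`↪`" of Cor 5.2 (iii) at the genuine global arithmetic data.

HONEST SCOPE: model/instance level; the `TPairVocabulary`/`GlobCarrier` instance `(W_F, C_F)` is NOT built here (it
presupposes a genuine §5 context); over such an instance `Cor52iiiKummerInjective` follows from
`globalKummerMap_injective_of` and `units_eq_one_of_fixed_of_forall_exists_fixed_pow` in two lines.  Universe `0`
(Mathlib's `groupCohomology`).  Classical Kummer theory / [AbsTopIII] Rmk 1.5.3 (i); nothing here bears on
[IUTchIII] Cor. 3.12 or takes a side.
-/

noncomputable section

open scoped Classical

namespace Literature.AnabelianGeometry.AbsoluteAnabelian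

open Field
open Literature.AnabelianGeometry.EtaleTheta

variable (F : Type) [Field F]

/-! ### The level-wise condition at the genuine global data -/

/-- **[AbsTopIII] Cor 5.2 (iii) `↪`, level-wise, at the genuine global arithmetic data of a number field**: for an
OPEN subgroup `J ⊆ G_F` and a `J`-fixed unit `a ∈ F̄^×` admitting, for every `n ≥ 1`, a `J`-fixed `n`-th root,
`a = 1` — `a` and these roots lie in the number field `F̄^J`, where `⋂_N (k^×)^N = 1` ([AbsTopIII] Rmk 1.5.3 (i));
in the tree this is Def 1.5 (b) for tori (`def_1_5_b_toral_of_isTorallyKummerFaithful`) through the kernel criterion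
`kummerMapFixed_injective_iff_absoluteGaloisGroup`.  This is exactly the hypothesis of abc-iut-w6-d033's
`globalKummerMap_injective_of` read at carrier `F̄^×` with the Galois action.
[cite: MochizukiAbsTopIII2015, Cor 5.2 (iii) p.119] -/
theorem units_eq_one_of_fixed_of_forall_exists_fixed_pow [NumberField F]
    (J : Subgroup (absoluteGaloisGroup F)) (hJ : IsOpen (J : Set (absoluteGaloisGroup F)))
    (a : (AlgebraicClosure F)ˣ) (ha : ∀ u ∈ J, u • a = a)
    (hroots : ∀ n : ℕ, 0 < n → ∃ b : (AlgebraicClosure F)ˣ, (∀ u ∈ J, u • b = b) ∧ b ^ n = a) :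
    a = 1 := by
  have hinj := AbsTopIII.def_1_5_b_toral_of_isTorallyKummerFaithful
    (AbsTopIII.isTorallyKummerFaithful_of_numberField F) J hJ
  rw [kummerMapFixed_injective_iff_absoluteGaloisGroup] at hinj
  have ha' : a ∈ invariants (A := (AlgebraicClosure F)ˣ) J := fun γ => ha γ γ.2
  have key := hinj ⟨a, ha'⟩ fun n => by
    obtain ⟨b, hb, hbn⟩ := hroots n n.pos
    exact ⟨⟨b, fun γ => hb γ γ.2⟩, Subtype.ext hbn⟩
  exact congrArg Subtype.val key

/-- The same packaged as [AbsTopIII] Def 1.5 (a) for the invariants: for an OPEN `J ⊆ G_F` the subgroup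
`(F̄^×)^J` of `J`-invariant units has no non-trivial infinitely divisible element
(`AbsTopIII.DivisibleElementsTrivial`) — the hypothesis shape of `globalKummerMap_injective_of_divisibleElementsTrivial`.
[cite: MochizukiAbsTopIII2015, Cor 5.2 (iii) p.119] -/
theorem divisibleElementsTrivial_invariants_of_isOpen [NumberField F]
    (J : Subgroup (absoluteGaloisGroup F)) (hJ : IsOpen (J : Set (absoluteGaloisGroup F))) :
    AbsTopIII.DivisibleElementsTrivial ↥(invariants (A := (AlgebraicClosure F)ˣ) J) := by
  refine ⟨fun x hx => Subtype.ext ?_⟩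
  have hxJ : ∀ u ∈ J, u • (x : (AlgebraicClosure F)ˣ) = x := fun u hu => x.2 ⟨u, hu⟩
  refine units_eq_one_of_fixed_of_forall_exists_fixed_pow F J hJ x hxJ fun n hn => ?_
  obtain ⟨y, hy⟩ := hx n hn
  exact ⟨y, fun u hu => y.2 ⟨u, hu⟩, congrArg Subtype.val hy⟩

/-! ### The Kummer map over all open subgroups of `G_F` is injective -/

/-- The system `J ↦ J` of subgroups of `G_F` indexed by the open subgroups under REVERSE inclusion is antitone
("`J` ranges over the open subgroups of `Π`"). [cite: MochizukiAbsTopIII2015, Cor 5.2 (iii) p.119] -/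
theorem openSubgroups_anti :
    ∀ ⦃i j : (OpenSubgroup (absoluteGaloisGroup F))ᵒᵈ⦄, i ≤ j →
      ((OrderDual.ofDual j : OpenSubgroup (absoluteGaloisGroup F)) : Subgroup (absoluteGaloisGroup F)) ≤
        ((OrderDual.ofDual i : OpenSubgroup (absoluteGaloisGroup F)) : Subgroup (absoluteGaloisGroup F)) :=
  fun _ _ h => OpenSubgroup.toSubgroup_le.mpr (OrderDual.ofDual_le_ofDual.mpr h)

/-- Hypothesis (c) of the Kummer-map construction at the genuine global data: `F̄^× = ⋃_J (F̄^×)^J` over the open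
subgroups `J ⊆ G_F` — the stabiliser of a unit `a` contains the open subgroup `Gal(F̄/F(a))` ("equipped with a
continuous action by `Π`", Def 5.1 (v) p.117). [cite: MochizukiAbsTopIII2015, Def 5.1 (v) p.117] -/
theorem isExhausted_units_openSubgroups :
    IsExhausted (G := absoluteGaloisGroup F) (AlgebraicClosure F)ˣ
      (fun i : (OpenSubgroup (absoluteGaloisGroup F))ᵒᵈ =>
        ((OrderDual.ofDual i : OpenSubgroup (absoluteGaloisGroup F)) : Subgroup (absoluteGaloisGroup F))) := by
  intro a
  -- the finite extension `F(a)` and its open fixing subgroup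
  let K : IntermediateField F (AlgebraicClosure F) := IntermediateField.adjoin F {(a : AlgebraicClosure F)}
  haveI : FiniteDimensional F K := IntermediateField.adjoin.finiteDimensional
    (Algebra.IsAlgebraic.isAlgebraic (a : AlgebraicClosure F)).isIntegral
  let J₀ : Subgroup (absoluteGaloisGroup F) :=
    K.fixingSubgroup.comap (absoluteGaloisGroup.toAlgEquiv F).toMonoidHom
  have hopen : IsOpen (J₀ : Set (absoluteGaloisGroup F)) :=
    (IntermediateField.fixingSubgroup_isOpen K).preimage (AbsTopIII.continuous_toAlgEquiv F)
  let U : OpenSubgroup (absoluteGaloisGroup F) := ⟨J₀, hopen⟩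
  refine ⟨OrderDual.toDual U, ?_⟩
  show ∀ γ : ↥((OrderDual.ofDual (OrderDual.toDual U) : OpenSubgroup (absoluteGaloisGroup F)) :
    Subgroup (absoluteGaloisGroup F)), γ • a = a
  rintro ⟨u, hu⟩
  have hu' : absoluteGaloisGroup.toAlgEquiv F u ∈ K.fixingSubgroup := Subgroup.mem_comap.mp hu
  have ha : absoluteGaloisGroup.toAlgEquiv F u (a : AlgebraicClosure F) = a :=
    (IntermediateField.mem_fixingSubgroup_iff _ _).mp hu' _
      (IntermediateField.mem_adjoin_simple_self F (a : AlgebraicClosure F))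
  exact Units.ext (by
    rw [Subgroup.mk_smul, Units.coe_smul, absoluteGaloisGroup.smul_def]
    exact ha)

/-- **[AbsTopIII] Cor 5.2 (iii), the `↪`, at the GENUINE global arithmetic data of a number field**: the Kummer map
`F̄^× → lim_{→ J} H¹(J, Λ(F̄^×))`, `J` over ALL open subgroups of `G_F` (abc-iut-L2-t3's `kummerMapHom`, LANA §6.1),
is INJECTIVE — by the kernel criterion of the direct limit (`kummerMapHom_injective_of`: a class vanishing in the
colimit vanishes at an open level `J`, where it gives `J`-fixed `n`-th roots for all `n`) and the level-wise
condition `units_eq_one_of_fixed_of_forall_exists_fixed_pow` ([AbsTopIII] Rmk 1.5.3 (i) for the number field `F̄^J`).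
[cite: MochizukiAbsTopIII2015, Cor 5.2 (iii) p.119] -/
theorem kummerMapHom_openSubgroups_injective [NumberField F] :
    Function.Injective
      (kummerMapHom (A := (AlgebraicClosure F)ˣ) (openSubgroups_anti F) (isExhausted_units_openSubgroups F)) := by
  refine kummerMapHom_injective_of _ (openSubgroups_anti F) (isExhausted_units_openSubgroups F) fun i a ha hroots => ?_
  have hJ : IsOpen (((OrderDual.ofDual i : OpenSubgroup (absoluteGaloisGroup F)) :
      Subgroup (absoluteGaloisGroup F)) : Set (absoluteGaloisGroup F)) := (OrderDual.ofDual i).isOpen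
  have haJ : ∀ u ∈ ((OrderDual.ofDual i : OpenSubgroup (absoluteGaloisGroup F)) : Subgroup (absoluteGaloisGroup F)),
      u • a = a := fun u hu => ha ⟨u, hu⟩
  refine units_eq_one_of_fixed_of_forall_exists_fixed_pow F _ hJ a haJ fun n hn => ?_
  obtain ⟨b, hb, hbn⟩ := hroots ⟨n, hn⟩
  exact ⟨b, fun u hu => hb ⟨u, hu⟩, hbn⟩

/-! ### v2: the same for every torally Kummer-faithful field (MLFs, sub-`p`-adic fields, …) -/

/-- **Level-wise condition for any torally Kummer-faithful field** ([AbsTopIII] Def 1.5 (b) for tori): for a field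
`k` of characteristic `0` with `⋂_N (k'^×)^N = 1` for all finite `k'/k` (`IsTorallyKummerFaithful`), an OPEN subgroup
`J ⊆ G_k` and a `J`-fixed unit `a ∈ k̄^×` admitting a `J`-fixed `n`-th root for every `n ≥ 1`, `a = 1`
(`def_1_5_b_toral_of_isTorallyKummerFaithful` through `kummerMapFixed_injective_iff_absoluteGaloisGroup`).
[cite: MochizukiAbsTopIII2015, Def 1.5 p.32] -/
theorem units_eq_one_of_fixed_of_forall_exists_fixed_pow_of_isTorallyKummerFaithful [CharZero F]
    (hF : AbsTopIII.IsTorallyKummerFaithful F)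
    (J : Subgroup (absoluteGaloisGroup F)) (hJ : IsOpen (J : Set (absoluteGaloisGroup F)))
    (a : (AlgebraicClosure F)ˣ) (ha : ∀ u ∈ J, u • a = a)
    (hroots : ∀ n : ℕ, 0 < n → ∃ b : (AlgebraicClosure F)ˣ, (∀ u ∈ J, u • b = b) ∧ b ^ n = a) :
    a = 1 := by
  have hinj := AbsTopIII.def_1_5_b_toral_of_isTorallyKummerFaithful hF J hJ
  rw [kummerMapFixed_injective_iff_absoluteGaloisGroup] at hinj
  have ha' : a ∈ invariants (A := (AlgebraicClosure F)ˣ) J := fun γ => ha γ γ.2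
  have key := hinj ⟨a, ha'⟩ fun n => by
    obtain ⟨b, hb, hbn⟩ := hroots n n.pos
    exact ⟨⟨b, fun γ => hb γ γ.2⟩, Subtype.ext hbn⟩
  exact congrArg Subtype.val key

/-- **The Kummer map over all open subgroups is injective for every torally Kummer-faithful field**: for `k` of
characteristic `0` with `IsTorallyKummerFaithful k`, the colimit Kummer map
`k̄^× → lim_{→ J open ≤ G_k} H¹(J, Λ(k̄^×))` (abc-iut-L2-t3's `kummerMapHom` over ALL open subgroups) is injective —
[AbsTopIII] Def 1.5 (b) for tori, all levels at once (kernel criterion of the direct limit,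
`kummerMapHom_injective_of`). [cite: MochizukiAbsTopIII2015, Def 1.5 p.32] -/
theorem kummerMapHom_openSubgroups_injective_of_isTorallyKummerFaithful [CharZero F]
    (hF : AbsTopIII.IsTorallyKummerFaithful F) :
    Function.Injective
      (kummerMapHom (A := (AlgebraicClosure F)ˣ) (openSubgroups_anti F) (isExhausted_units_openSubgroups F)) := by
  refine kummerMapHom_injective_of _ (openSubgroups_anti F) (isExhausted_units_openSubgroups F) fun i a ha hroots => ?_
  have hJ : IsOpen (((OrderDual.ofDual i : OpenSubgroup (absoluteGaloisGroup F)) :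
      Subgroup (absoluteGaloisGroup F)) : Set (absoluteGaloisGroup F)) := (OrderDual.ofDual i).isOpen
  have haJ : ∀ u ∈ ((OrderDual.ofDual i : OpenSubgroup (absoluteGaloisGroup F)) : Subgroup (absoluteGaloisGroup F)),
      u • a = a := fun u hu => ha ⟨u, hu⟩
  refine units_eq_one_of_fixed_of_forall_exists_fixed_pow_of_isTorallyKummerFaithful F hF _ hJ a haJ
    fun n hn => ?_
  obtain ⟨b, hb, hbn⟩ := hroots ⟨n, hn⟩
  exact ⟨b, fun u hu => hb ⟨u, hu⟩, hbn⟩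

/-- **MLF case** ([AbsTopIII] Prop 3.2 (ii) / Cor 1.10 (d) setting: the Kummer map of the MLF-Galois pair
`(G_k ↷ k̄^×)` over all open subgroups): for an MLF `k` (the cell's `IsMLF`; torally Kummer-faithful by Rmk 1.5.4 (i),
`IsMLF.isTorallyKummerFaithful`), the Kummer map `k̄^× → lim_{→ J open} H¹(J, Λ(k̄^×))` is injective.
[cite: MochizukiAbsTopIII2015, Rmk 1.5.4 (i) p.33] -/
theorem kummerMapHom_openSubgroups_injective_of_isMLF [CharZero F] (hF : IsMLF F) :
    Function.Injective
      (kummerMapHom (A := (AlgebraicClosure F)ˣ) (openSubgroups_anti F) (isExhausted_units_openSubgroups F)) :=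
  kummerMapHom_openSubgroups_injective_of_isTorallyKummerFaithful F hF.isTorallyKummerFaithful

/-- **Sub-`p`-adic case** ([AbsTopIII] Thm 1.9 setting; Rmk 1.5.4 (i) torus half `IsSubpadic.isTorallyKummerFaithful`):
for a sub-`p`-adic field `k` the Kummer map `k̄^× → lim_{→ J open} H¹(J, Λ(k̄^×))` is injective.
[cite: MochizukiAbsTopIII2015, Rmk 1.5.4 (i) p.33] -/
theorem kummerMapHom_openSubgroups_injective_of_isSubpadic [CharZero F] (hF : AbsTopIII.IsSubpadic F) :
    Function.Injective
      (kummerMapHom (A := (AlgebraicClosure F)ˣ) (openSubgroups_anti F) (isExhausted_units_openSubgroups F)) :=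
  kummerMapHom_openSubgroups_injective_of_isTorallyKummerFaithful F hF.isTorallyKummerFaithful

end Literature.AnabelianGeometry.AbsoluteAnabelian

end
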